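import Summits.Ventures.LatticeQCDFlow.Scaling.StarHubChainFirstOrder

/-!
HONEST FRAMING: exact (Metropolis-corrected) sampling algorithms for lattice gauge theory; figures
of merit are autocorrelation/cost numbers at stated couplings and volumes; no continuum-physics
claim.

# SyncPairKernel — THE SYNCHRONOUS COUPLING OF THE TWO ONE-COPY HUB CHAINS OF A PAIR STATE IN COMPOSITION VARIABLES (COMMON LEVELS MATCHED BY CONTENT, THE DIFFERING LEVELS
# PAIRED UNIFORMLY, ONE SHARED ACCEPTANCE COIN) IS A PAIR KERNEL ON `S × S` WITH MARGINALS `K_X`, `K_Y` — THE CONCRETE INPUT OF `Scaling/ResolventPairCoupling` (lean-2 GEN-36, ours)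

Venture-side (OURS).  Cell `lqcd-flow` (pub-lqcd), unit `pub-lqcd-lean-2-g36`, 2026-08-29.  Chapter W (item 1 (i) at finite swap odds), file 9.  From hubs `(h_X, h_Y)` the two copies
have level counts `L_X = N_X − δ_(h_X)`, `L_Y = N_Y − δ_(h_Y)` (as reals), common part `C = L_X ∧ L_Y`, surpluses `P_X = L_X − C`, `P_Y = L_Y − C` of equal mass `d`.  One coupled
attempt: with probability `C(v)/K` both copies address a common level of content `v`, with probability `P_X(a)P_Y(b)/(dK)` copy `X` addresses a surplus level of content `a` and copy `Y`
one of content `b`; in both cases ONE uniform coin decides the two acceptances (thresholds `acc(h_X,·)`, `acc(h_Y,·)`): both move w.p. `min`, the likelier alone w.p. the excess,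
none w.p. `1 − max`.  On pairs with an absent hub content the kernel is the product of the two rows (any coupling would do there).  PROVED: the kernel is non-negative and its two
marginals are the hub chains `K_X`, `K_Y` of `Scaling/StarHubChainFirstOrder` row by row (`syncPair_marginal_fst`, `syncPair_marginal_snd`) — exactly the hypotheses `hmX`, `hmY`,
`hKp0` of `Scaling/ResolventPairCoupling`.  Hypothesis-equations, no definitions.

## What is proved

* §1 coin algebra: `coin_nonneg`, `coin_fst` (`min + (α − min) = α`, `(β − min) + (1 − max) = 1 − α`), `coin_snd`.
* §2 level counts: `levels_nonneg`, `levels_sum` (`Σ L = K`), `surplus_nonneg`, `surplus_sum_eq` (`Σ P_X = Σ P_Y`).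
* §3 **`syncPair_nonneg`**, `syncPair_rowX` (`Σ_{b'}` of the synchronous part `= Σ_v (L_X(v)/K)(acc(h_X,v)𝟙{a'=v} + (1−acc(h_X,v))𝟙{a'=h_X})`), `hubRow_eq_levels` (that is `K_X(h_X,a')`),
  **`syncPair_marginal_fst`**, **`syncPair_marginal_snd`**.

Reading (toy of this generation, NOTHING CLAIMED): the pair resolvent of this kernel attains the optimal cycle-end criterion value in all worst pair states examined for `q = 3`
(within 30 % for `q = 4`), so a certificate may be sought as one sub-solution for THIS kernel.  NOT CLAIMED: any certificate.  Literature grade (cell rule): OWN, elementary; nothing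
cited as a fact; no new bib keys.
-/

open Finset

namespace Summit.Ventures.LatticeQCDFlow.Scaling

section SyncPair
variable {S : Type*} [Fintype S] [DecidableEq S]

/-! ## §1 The shared coin -/

omit [Fintype S] [DecidableEq S] in
/-- The four coin weights are non-negative for thresholds in `[0,1]`. [ours] -/
theorem coin_nonneg {α β : ℝ} (hα0 : 0 ≤ α) (hα1 : α ≤ 1) (hβ0 : 0 ≤ β) (hβ1 : β ≤ 1) :
    0 ≤ min α β ∧ 0 ≤ α - min α β ∧ 0 ≤ β - min α β ∧ 0 ≤ 1 - max α β :=
  ⟨le_min hα0 hβ0, sub_nonneg.mpr (min_le_left _ _), sub_nonneg.mpr (min_le_right _ _), sub_nonneg.mpr (max_le hα1 hβ1)⟩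

omit [Fintype S] [DecidableEq S] in
/-- First marginal of the coin: `min + (α − min) = α` and `(β − min) + (1 − max) = 1 − α`. [ours] -/
theorem coin_fst (α β : ℝ) : min α β + (α - min α β) = α ∧ (β - min α β) + (1 - max α β) = 1 - α := by
  refine ⟨by ring, ?_⟩
  have := min_add_max α β
  linarith

omit [Fintype S] [DecidableEq S] in
/-- Second marginal of the coin: `min + (β − min) = β` and `(α − min) + (1 − max) = 1 − β`. [ours] -/
theorem coin_snd (α β : ℝ) : min α β + (β - min α β) = β ∧ (α - min α β) + (1 - max α β) = 1 - β := by
  refine ⟨by ring, ?_⟩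
  have := min_add_max α β
  linarith

/-! ## §2 Level counts of a pair of hubs -/

variable {K : ℕ} {N : S → ℕ}

omit [Fintype S] in
/-- Level counts are non-negative at a present hub. [ours] -/
theorem levels_nonneg {h : S} (hh : N h ≠ 0) (v : S) : 0 ≤ (N v : ℝ) - (if v = h then 1 else 0) := by
  by_cases hv : v = h
  · subst hv; simp only [if_true]; have : (1 : ℝ) ≤ N v := by exact_mod_cast Nat.one_le_iff_ne_zero.mpr hh
    linarith
  · simp [hv]

/-- `Σ_v L(v) = K` when `Σ N = K + 1`. [ours] -/
theorem levels_sum (hsum : ∑ v, N v = K + 1) (h : S) : ∑ v, ((N v : ℝ) - (if v = h then 1 else 0)) = K := by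
  rw [sum_sub_distrib, sum_ite_eq' univ h]; simp only [mem_univ, if_true]
  rw [← Nat.cast_sum, hsum]; push_cast; ring

variable {NX NY : S → ℕ} {C PX PY : S → S → S → ℝ} {d : S → S → ℝ}

omit [Fintype S] in
/-- Surpluses are non-negative and the common part is at most each level count. [ours] -/
theorem surplus_nonneg (hC : ∀ hX hY v, C hX hY v = min ((NX v : ℝ) - (if v = hX then 1 else 0)) ((NY v : ℝ) - (if v = hY then 1 else 0)))
    (hPX : ∀ hX hY v, PX hX hY v = ((NX v : ℝ) - (if v = hX then 1 else 0)) - C hX hY v)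
    (hPY : ∀ hX hY v, PY hX hY v = ((NY v : ℝ) - (if v = hY then 1 else 0)) - C hX hY v)
    {hX hY : S} (hhX : NX hX ≠ 0) (hhY : NY hY ≠ 0) (v : S) : 0 ≤ C hX hY v ∧ 0 ≤ PX hX hY v ∧ 0 ≤ PY hX hY v := by
  rw [hPX, hPY, hC]
  exact ⟨le_min (levels_nonneg hhX v) (levels_nonneg hhY v), sub_nonneg.mpr (min_le_left _ _), sub_nonneg.mpr (min_le_right _ _)⟩

/-- The two surpluses have the same mass (both level counts sum to `K`). [ours] -/
theorem surplus_sum_eq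
    (hPX : ∀ hX hY v, PX hX hY v = ((NX v : ℝ) - (if v = hX then 1 else 0)) - C hX hY v)
    (hPY : ∀ hX hY v, PY hX hY v = ((NY v : ℝ) - (if v = hY then 1 else 0)) - C hX hY v)
    (hsumX : ∑ v, NX v = K + 1) (hsumY : ∑ v, NY v = K + 1) (hX hY : S) : ∑ v, PX hX hY v = ∑ v, PY hX hY v := by
  have e : ∀ v, PX hX hY v - PY hX hY v = ((NX v : ℝ) - (if v = hX then 1 else 0)) - ((NY v : ℝ) - (if v = hY then 1 else 0)) := by
    intro v; rw [hPX, hPY]; ring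
  rw [← sub_eq_zero, ← sum_sub_distrib, sum_congr rfl fun v _ => e v, sum_sub_distrib, levels_sum hsumX, levels_sum hsumY, sub_self]

/-! ## §3 The synchronous pair kernel and its marginals -/

variable {W : S → ℝ} {acc : S → S → ℝ} {KX KY : S → S → ℝ} {Kp : S × S → S × S → ℝ}

/-- Indicator sums over the second coordinate. [ours] -/
theorem ind_sum_snd (a' x : S) (y : S) : ∑ b', (if a' = x ∧ b' = y then (1 : ℝ) else 0) = if a' = x then 1 else 0 := by
  by_cases h : a' = x
  · simp [h]
  · simp [h]

/-- Indicator sums over the first coordinate. [ours] -/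
theorem ind_sum_fst (b' y : S) (x : S) : ∑ a', (if a' = x ∧ b' = y then (1 : ℝ) else 0) = if b' = y then 1 else 0 := by
  by_cases h : b' = y
  · simp [h]
  · simp [h]

/-- **The synchronous kernel is non-negative** (legal rows: all weights non-negative; absent rows: product of two non-negative rows). [ours] -/
theorem syncPair_nonneg (hW : ∀ v, 0 < W v) (hacc : ∀ h v, acc h v = min 1 (W h / W v)) (hK : 1 ≤ K)
    (hsumX : ∑ v, NX v = K + 1) (hsumY : ∑ v, NY v = K + 1)
    (hKX : ∀ h v, h ≠ v → KX h v = if NX h = 0 then 0 else (NX v : ℝ) / K * acc h v) (hKXd : ∀ h, KX h h = 1 - ∑ v ∈ univ.erase h, KX h v)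
    (hKY : ∀ h v, h ≠ v → KY h v = if NY h = 0 then 0 else (NY v : ℝ) / K * acc h v) (hKYd : ∀ h, KY h h = 1 - ∑ v ∈ univ.erase h, KY h v)
    (hC : ∀ hX hY v, C hX hY v = min ((NX v : ℝ) - (if v = hX then 1 else 0)) ((NY v : ℝ) - (if v = hY then 1 else 0)))
    (hPX : ∀ hX hY v, PX hX hY v = ((NX v : ℝ) - (if v = hX then 1 else 0)) - C hX hY v)
    (hPY : ∀ hX hY v, PY hX hY v = ((NY v : ℝ) - (if v = hY then 1 else 0)) - C hX hY v)
    (hd : ∀ hX hY, d hX hY = ∑ v, PX hX hY v)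
    (hKp : ∀ hX hY a' b', Kp (hX, hY) (a', b') = if NX hX = 0 ∨ NY hY = 0 then KX hX a' * KY hY b' else
      (∑ v, C hX hY v / K * (min (acc hX v) (acc hY v) * (if a' = v ∧ b' = v then (1 : ℝ) else 0)
          + (acc hX v - min (acc hX v) (acc hY v)) * (if a' = v ∧ b' = hY then (1 : ℝ) else 0)
          + (acc hY v - min (acc hX v) (acc hY v)) * (if a' = hX ∧ b' = v then (1 : ℝ) else 0)
          + (1 - max (acc hX v) (acc hY v)) * (if a' = hX ∧ b' = hY then (1 : ℝ) else 0))
      + ∑ a, ∑ b, PX hX hY a * PY hX hY b / (d hX hY * K) * (min (acc hX a) (acc hY b) * (if a' = a ∧ b' = b then (1 : ℝ) else 0)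
          + (acc hX a - min (acc hX a) (acc hY b)) * (if a' = a ∧ b' = hY then (1 : ℝ) else 0)
          + (acc hY b - min (acc hX a) (acc hY b)) * (if a' = hX ∧ b' = b then (1 : ℝ) else 0)
          + (1 - max (acc hX a) (acc hY b)) * (if a' = hX ∧ b' = hY then (1 : ℝ) else 0))))
    (s s' : S × S) : 0 ≤ Kp s s' := by
  obtain ⟨hX, hY⟩ := s; obtain ⟨a', b'⟩ := s'
  rw [hKp]
  have ha0 := starHub_acc_nonneg hW hacc
  have ha1 := starHub_acc_le_one hacc
  have hcoin : ∀ x y u v, 0 ≤ min (acc x u) (acc y v) * (if a' = u ∧ b' = v then (1 : ℝ) else 0)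
          + (acc x u - min (acc x u) (acc y v)) * (if a' = u ∧ b' = y then (1 : ℝ) else 0)
          + (acc y v - min (acc x u) (acc y v)) * (if a' = x ∧ b' = v then (1 : ℝ) else 0)
          + (1 - max (acc x u) (acc y v)) * (if a' = x ∧ b' = y then (1 : ℝ) else 0) := by
    intro x y u v
    obtain ⟨h1, h2, h3, h4⟩ := coin_nonneg (ha0 x u) (ha1 x u) (ha0 y v) (ha1 y v)
    have i1 : (0 : ℝ) ≤ (if a' = u ∧ b' = v then (1 : ℝ) else 0) := by split_ifs <;> norm_num
    have i2 : (0 : ℝ) ≤ (if a' = u ∧ b' = y then (1 : ℝ) else 0) := by split_ifs <;> norm_num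
    have i3 : (0 : ℝ) ≤ (if a' = x ∧ b' = v then (1 : ℝ) else 0) := by split_ifs <;> norm_num
    have i4 : (0 : ℝ) ≤ (if a' = x ∧ b' = y then (1 : ℝ) else 0) := by split_ifs <;> norm_num
    positivity
  by_cases hleg : NX hX = 0 ∨ NY hY = 0
  · rw [if_pos hleg]
    exact mul_nonneg (starHub_nonneg hW hacc hKX hKXd hK hsumX hX a') (starHub_nonneg hW hacc hKY hKYd hK hsumY hY b')
  · rw [if_neg hleg]
    have hleg : NX hX ≠ 0 ∧ NY hY ≠ 0 := not_or.mp hleg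
    have hK0 : (0 : ℝ) ≤ K := Nat.cast_nonneg _
    have hsp := surplus_nonneg hC hPX hPY hleg.1 hleg.2
    have hd0 : 0 ≤ d hX hY := by rw [hd]; exact sum_nonneg fun v _ => (hsp v).2.1
    refine add_nonneg (sum_nonneg fun v _ => mul_nonneg (div_nonneg (hsp v).1 hK0) (hcoin hX hY v v))
      (sum_nonneg fun a _ => sum_nonneg fun b _ => mul_nonneg (div_nonneg (mul_nonneg (hsp a).2.1 (hsp b).2.2) (mul_nonneg hd0 hK0)) (hcoin hX hY a b))

/-- **The first marginal of the synchronous part in level form:**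
`Σ_{b'} SYNC((h_X,h_Y),(a',b')) = Σ_v (L_X(v)/K)·(acc(h_X,v)𝟙{a'=v} + (1 − acc(h_X,v))𝟙{a'=h_X})`. [ours] -/
theorem syncPair_rowX (hsumX : ∑ v, NX v = K + 1) (hsumY : ∑ v, NY v = K + 1)
    (hC : ∀ hX hY v, C hX hY v = min ((NX v : ℝ) - (if v = hX then 1 else 0)) ((NY v : ℝ) - (if v = hY then 1 else 0)))
    (hPX : ∀ hX hY v, PX hX hY v = ((NX v : ℝ) - (if v = hX then 1 else 0)) - C hX hY v)
    (hPY : ∀ hX hY v, PY hX hY v = ((NY v : ℝ) - (if v = hY then 1 else 0)) - C hX hY v)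
    (hd : ∀ hX hY, d hX hY = ∑ v, PX hX hY v) (hX hY a' : S) :
    ∑ b', ((∑ v, C hX hY v / K * (min (acc hX v) (acc hY v) * (if a' = v ∧ b' = v then (1 : ℝ) else 0)
          + (acc hX v - min (acc hX v) (acc hY v)) * (if a' = v ∧ b' = hY then (1 : ℝ) else 0)
          + (acc hY v - min (acc hX v) (acc hY v)) * (if a' = hX ∧ b' = v then (1 : ℝ) else 0)
          + (1 - max (acc hX v) (acc hY v)) * (if a' = hX ∧ b' = hY then (1 : ℝ) else 0))
      + ∑ a, ∑ b, PX hX hY a * PY hX hY b / (d hX hY * K) * (min (acc hX a) (acc hY b) * (if a' = a ∧ b' = b then (1 : ℝ) else 0)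
          + (acc hX a - min (acc hX a) (acc hY b)) * (if a' = a ∧ b' = hY then (1 : ℝ) else 0)
          + (acc hY b - min (acc hX a) (acc hY b)) * (if a' = hX ∧ b' = b then (1 : ℝ) else 0)
          + (1 - max (acc hX a) (acc hY b)) * (if a' = hX ∧ b' = hY then (1 : ℝ) else 0))))
      = ∑ v, ((NX v : ℝ) - (if v = hX then 1 else 0)) / K * (acc hX v * (if a' = v then (1 : ℝ) else 0) + (1 - acc hX v) * (if a' = hX then (1 : ℝ) else 0)) := by
  -- sum over `b'` inside
  rw [sum_add_distrib, Finset.sum_comm]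
  have hcoinX : ∀ (x y u v : S) (w : ℝ), ∑ b', w * (min (acc x u) (acc y v) * (if a' = u ∧ b' = v then (1 : ℝ) else 0)
          + (acc x u - min (acc x u) (acc y v)) * (if a' = u ∧ b' = y then (1 : ℝ) else 0)
          + (acc y v - min (acc x u) (acc y v)) * (if a' = x ∧ b' = v then (1 : ℝ) else 0)
          + (1 - max (acc x u) (acc y v)) * (if a' = x ∧ b' = y then (1 : ℝ) else 0))
        = w * (acc x u * (if a' = u then (1 : ℝ) else 0) + (1 - acc x u) * (if a' = x then (1 : ℝ) else 0)) := by
    intro x y u v w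
    rw [← mul_sum, sum_add_distrib, sum_add_distrib, sum_add_distrib, ← mul_sum, ← mul_sum, ← mul_sum, ← mul_sum,
      ind_sum_snd, ind_sum_snd, ind_sum_snd, ind_sum_snd]
    obtain ⟨c1, c2⟩ := coin_fst (acc x u) (acc y v)
    congr 1
    calc _ = (min (acc x u) (acc y v) + (acc x u - min (acc x u) (acc y v))) * (if a' = u then (1 : ℝ) else 0)
          + ((acc y v - min (acc x u) (acc y v)) + (1 - max (acc x u) (acc y v))) * (if a' = x then (1 : ℝ) else 0) := by ring
      _ = _ := by rw [c1, c2]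
  have h1 : ∑ v, ∑ b', C hX hY v / K * (min (acc hX v) (acc hY v) * (if a' = v ∧ b' = v then (1 : ℝ) else 0)
          + (acc hX v - min (acc hX v) (acc hY v)) * (if a' = v ∧ b' = hY then (1 : ℝ) else 0)
          + (acc hY v - min (acc hX v) (acc hY v)) * (if a' = hX ∧ b' = v then (1 : ℝ) else 0)
          + (1 - max (acc hX v) (acc hY v)) * (if a' = hX ∧ b' = hY then (1 : ℝ) else 0))
      = ∑ v, C hX hY v / K * (acc hX v * (if a' = v then (1 : ℝ) else 0) + (1 - acc hX v) * (if a' = hX then (1 : ℝ) else 0)) :=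
    sum_congr rfl fun v _ => hcoinX hX hY v v _
  rw [h1]
  -- the surplus part: `Σ_{b'} Σ_a Σ_b = Σ_a (Σ_b PY b) PX a/(dK) (...)`
  have h2 : ∑ b', ∑ a, ∑ b, PX hX hY a * PY hX hY b / (d hX hY * K) * (min (acc hX a) (acc hY b) * (if a' = a ∧ b' = b then (1 : ℝ) else 0)
          + (acc hX a - min (acc hX a) (acc hY b)) * (if a' = a ∧ b' = hY then (1 : ℝ) else 0)
          + (acc hY b - min (acc hX a) (acc hY b)) * (if a' = hX ∧ b' = b then (1 : ℝ) else 0)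
          + (1 - max (acc hX a) (acc hY b)) * (if a' = hX ∧ b' = hY then (1 : ℝ) else 0))
      = ∑ a, PX hX hY a / K * (acc hX a * (if a' = a then (1 : ℝ) else 0) + (1 - acc hX a) * (if a' = hX then (1 : ℝ) else 0)) := by
    rw [Finset.sum_comm]
    refine sum_congr rfl fun a _ => ?_
    rw [Finset.sum_comm]
    have : ∀ b, ∑ b', PX hX hY a * PY hX hY b / (d hX hY * K) * (min (acc hX a) (acc hY b) * (if a' = a ∧ b' = b then (1 : ℝ) else 0)
          + (acc hX a - min (acc hX a) (acc hY b)) * (if a' = a ∧ b' = hY then (1 : ℝ) else 0)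
          + (acc hY b - min (acc hX a) (acc hY b)) * (if a' = hX ∧ b' = b then (1 : ℝ) else 0)
          + (1 - max (acc hX a) (acc hY b)) * (if a' = hX ∧ b' = hY then (1 : ℝ) else 0))
        = PX hX hY a * PY hX hY b / (d hX hY * K) * (acc hX a * (if a' = a then (1 : ℝ) else 0) + (1 - acc hX a) * (if a' = hX then (1 : ℝ) else 0)) :=
      fun b => hcoinX hX hY a b _
    simp_rw [this]
    rw [← sum_mul]
    congr 1
    -- `Σ_b PX a PY b/(dK) = PX a/K`
    rw [show (∑ b, PX hX hY a * PY hX hY b / (d hX hY * K)) = PX hX hY a * (∑ b, PY hX hY b) / (d hX hY * K) by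
      rw [mul_sum, sum_div]]
    rw [← surplus_sum_eq hPX hPY hsumX hsumY hX hY, ← hd]
    by_cases hd0 : d hX hY = 0
    · -- then `PX a = 0`
      have hsp : ∀ v, 0 ≤ PX hX hY v := by
        intro v; rw [hPX, hC]; exact sub_nonneg.mpr (min_le_left _ _)
      have hPa : PX hX hY a = 0 := by
        have := (sum_eq_zero_iff_of_nonneg fun v _ => hsp v).mp (by rw [← hd]; exact hd0) a (mem_univ a); exact this
      rw [hPa]; simp
    · field_simp
  rw [h2, ← sum_add_distrib]
  refine sum_congr rfl fun v _ => ?_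
  rw [hPX]; ring

/-- **The level form is the hub chain's row:** `Σ_v (L_X(v)/K)(acc(h,v)𝟙{a'=v} + (1−acc(h,v))𝟙{a'=h}) = K_X(h,a')` for a present hub `h` (`K ≥ 1`). [ours] -/
theorem hubRow_eq_levels (hW : ∀ v, 0 < W v) (hacc : ∀ h v, acc h v = min 1 (W h / W v)) (hK : 1 ≤ K) (hsumX : ∑ v, NX v = K + 1)
    (hKX : ∀ h v, h ≠ v → KX h v = if NX h = 0 then 0 else (NX v : ℝ) / K * acc h v) (hKXd : ∀ h, KX h h = 1 - ∑ v ∈ univ.erase h, KX h v)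
    {h : S} (hh : NX h ≠ 0) (a' : S) :
    ∑ v, ((NX v : ℝ) - (if v = h then 1 else 0)) / K * (acc h v * (if a' = v then (1 : ℝ) else 0) + (1 - acc h v) * (if a' = h then (1 : ℝ) else 0)) = KX h a' := by
  have hKne : (K : ℝ) ≠ 0 := Nat.cast_ne_zero.mpr (by omega)
  by_cases ha : a' = h
  · subst ha
    have hacc1 : acc a' a' = 1 := by rw [hacc, div_self (ne_of_gt (hW a')), min_self]
    have e1 : ∀ v, ((NX v : ℝ) - (if v = a' then 1 else 0)) / K * (acc a' v * (if a' = v then (1 : ℝ) else 0) + (1 - acc a' v) * (if a' = a' then (1 : ℝ) else 0))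
        = ((NX v : ℝ) - (if v = a' then 1 else 0)) / K - (if v = a' then 0 else ((NX v : ℝ) / K * acc a' v)) := by
      intro v
      by_cases hv : v = a'
      · subst hv; simp [hacc1]
      · have hv' : ¬ a' = v := fun e => hv e.symm
        simp only [hv, hv', if_false, if_true]; ring
    rw [Finset.sum_congr rfl fun v _ => e1 v]
    rw [sum_sub_distrib, ← sum_div, levels_sum hsumX, div_self hKne, hKXd, ← Finset.sum_erase_add univ _ (mem_univ a')]
    simp only [if_true, add_zero]
    congr 1
    refine sum_congr rfl fun v hv => ?_
    rw [if_neg (ne_of_mem_erase hv), hKX a' v (ne_of_mem_erase hv).symm, if_neg hh]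
  · have ha' : ¬ h = a' := fun e => ha e.symm
    simp only [ha, if_false, mul_zero, add_zero]
    rw [Finset.sum_eq_single a']
    · simp only [if_true, mul_one, ha, if_false, sub_zero]
      rw [hKX h a' ha', if_neg hh]
    · intro v _ hv; have : ¬ a' = v := fun e => hv e.symm
      simp [this]
    · intro h0; exact absurd (mem_univ a') h0


/-- **The second marginal of the synchronous part in level form:**
`Σ_{a'} SYNC((h_X,h_Y),(a',b')) = Σ_v (L_Y(v)/K)·(acc(h_Y,v)𝟙{b'=v} + (1 − acc(h_Y,v))𝟙{b'=h_Y})`. [ours] -/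
theorem syncPair_rowY (hsumX : ∑ v, NX v = K + 1) (hsumY : ∑ v, NY v = K + 1)
    (hC : ∀ hX hY v, C hX hY v = min ((NX v : ℝ) - (if v = hX then 1 else 0)) ((NY v : ℝ) - (if v = hY then 1 else 0)))
    (hPX : ∀ hX hY v, PX hX hY v = ((NX v : ℝ) - (if v = hX then 1 else 0)) - C hX hY v)
    (hPY : ∀ hX hY v, PY hX hY v = ((NY v : ℝ) - (if v = hY then 1 else 0)) - C hX hY v)
    (hd : ∀ hX hY, d hX hY = ∑ v, PX hX hY v) (hX hY b' : S) :
    ∑ a', ((∑ v, C hX hY v / K * (min (acc hX v) (acc hY v) * (if a' = v ∧ b' = v then (1 : ℝ) else 0)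
          + (acc hX v - min (acc hX v) (acc hY v)) * (if a' = v ∧ b' = hY then (1 : ℝ) else 0)
          + (acc hY v - min (acc hX v) (acc hY v)) * (if a' = hX ∧ b' = v then (1 : ℝ) else 0)
          + (1 - max (acc hX v) (acc hY v)) * (if a' = hX ∧ b' = hY then (1 : ℝ) else 0))
      + ∑ a, ∑ b, PX hX hY a * PY hX hY b / (d hX hY * K) * (min (acc hX a) (acc hY b) * (if a' = a ∧ b' = b then (1 : ℝ) else 0)
          + (acc hX a - min (acc hX a) (acc hY b)) * (if a' = a ∧ b' = hY then (1 : ℝ) else 0)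
          + (acc hY b - min (acc hX a) (acc hY b)) * (if a' = hX ∧ b' = b then (1 : ℝ) else 0)
          + (1 - max (acc hX a) (acc hY b)) * (if a' = hX ∧ b' = hY then (1 : ℝ) else 0))))
      = ∑ v, ((NY v : ℝ) - (if v = hY then 1 else 0)) / K * (acc hY v * (if b' = v then (1 : ℝ) else 0) + (1 - acc hY v) * (if b' = hY then (1 : ℝ) else 0)) := by
  rw [sum_add_distrib, Finset.sum_comm]
  have hcoinY : ∀ (x y u v : S) (w : ℝ), ∑ a', w * (min (acc x u) (acc y v) * (if a' = u ∧ b' = v then (1 : ℝ) else 0)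
          + (acc x u - min (acc x u) (acc y v)) * (if a' = u ∧ b' = y then (1 : ℝ) else 0)
          + (acc y v - min (acc x u) (acc y v)) * (if a' = x ∧ b' = v then (1 : ℝ) else 0)
          + (1 - max (acc x u) (acc y v)) * (if a' = x ∧ b' = y then (1 : ℝ) else 0))
        = w * (acc y v * (if b' = v then (1 : ℝ) else 0) + (1 - acc y v) * (if b' = y then (1 : ℝ) else 0)) := by
    intro x y u v w
    rw [← mul_sum, sum_add_distrib, sum_add_distrib, sum_add_distrib, ← mul_sum, ← mul_sum, ← mul_sum, ← mul_sum,
      ind_sum_fst, ind_sum_fst, ind_sum_fst, ind_sum_fst]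
    obtain ⟨c1, c2⟩ := coin_snd (acc x u) (acc y v)
    congr 1
    calc _ = (min (acc x u) (acc y v) + (acc y v - min (acc x u) (acc y v))) * (if b' = v then (1 : ℝ) else 0)
          + ((acc x u - min (acc x u) (acc y v)) + (1 - max (acc x u) (acc y v))) * (if b' = y then (1 : ℝ) else 0) := by ring
      _ = _ := by rw [c1, c2]
  have h1 : ∑ v, ∑ a', C hX hY v / K * (min (acc hX v) (acc hY v) * (if a' = v ∧ b' = v then (1 : ℝ) else 0)
          + (acc hX v - min (acc hX v) (acc hY v)) * (if a' = v ∧ b' = hY then (1 : ℝ) else 0)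
          + (acc hY v - min (acc hX v) (acc hY v)) * (if a' = hX ∧ b' = v then (1 : ℝ) else 0)
          + (1 - max (acc hX v) (acc hY v)) * (if a' = hX ∧ b' = hY then (1 : ℝ) else 0))
      = ∑ v, C hX hY v / K * (acc hY v * (if b' = v then (1 : ℝ) else 0) + (1 - acc hY v) * (if b' = hY then (1 : ℝ) else 0)) :=
    sum_congr rfl fun v _ => hcoinY hX hY v v _
  rw [h1]
  have h2 : ∑ a', ∑ a, ∑ b, PX hX hY a * PY hX hY b / (d hX hY * K) * (min (acc hX a) (acc hY b) * (if a' = a ∧ b' = b then (1 : ℝ) else 0)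
          + (acc hX a - min (acc hX a) (acc hY b)) * (if a' = a ∧ b' = hY then (1 : ℝ) else 0)
          + (acc hY b - min (acc hX a) (acc hY b)) * (if a' = hX ∧ b' = b then (1 : ℝ) else 0)
          + (1 - max (acc hX a) (acc hY b)) * (if a' = hX ∧ b' = hY then (1 : ℝ) else 0))
      = ∑ b, PY hX hY b / K * (acc hY b * (if b' = b then (1 : ℝ) else 0) + (1 - acc hY b) * (if b' = hY then (1 : ℝ) else 0)) := by
    rw [Finset.sum_comm]
    rw [show (∑ a, ∑ a', ∑ b, PX hX hY a * PY hX hY b / (d hX hY * K) * (min (acc hX a) (acc hY b) * (if a' = a ∧ b' = b then (1 : ℝ) else 0)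
          + (acc hX a - min (acc hX a) (acc hY b)) * (if a' = a ∧ b' = hY then (1 : ℝ) else 0)
          + (acc hY b - min (acc hX a) (acc hY b)) * (if a' = hX ∧ b' = b then (1 : ℝ) else 0)
          + (1 - max (acc hX a) (acc hY b)) * (if a' = hX ∧ b' = hY then (1 : ℝ) else 0)))
        = ∑ a, ∑ b, PX hX hY a * PY hX hY b / (d hX hY * K) * (acc hY b * (if b' = b then (1 : ℝ) else 0) + (1 - acc hY b) * (if b' = hY then (1 : ℝ) else 0)) from
      sum_congr rfl fun a _ => by rw [Finset.sum_comm]; exact sum_congr rfl fun b _ => hcoinY hX hY a b _]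
    rw [Finset.sum_comm]
    refine sum_congr rfl fun b _ => ?_
    rw [← sum_mul]
    congr 1
    rw [show (∑ a, PX hX hY a * PY hX hY b / (d hX hY * K)) = (∑ a, PX hX hY a) * PY hX hY b / (d hX hY * K) by
      rw [sum_mul, sum_div], ← hd]
    by_cases hd0 : d hX hY = 0
    · have hsp : ∀ v, 0 ≤ PY hX hY v := by
        intro v; rw [hPY, hC]; exact sub_nonneg.mpr (min_le_right _ _)
      have hsum0 : ∑ v, PY hX hY v = 0 := by rw [← surplus_sum_eq hPX hPY hsumX hsumY hX hY, ← hd]; exact hd0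
      have hPb : PY hX hY b = 0 := (sum_eq_zero_iff_of_nonneg fun v _ => hsp v).mp hsum0 b (mem_univ b)
      rw [hPb]; simp
    · field_simp
  rw [h2, ← sum_add_distrib]
  refine sum_congr rfl fun v _ => ?_
  rw [hPY]; ring

/-- **THE FIRST MARGINAL IS `K_X`** (row by row, every pair of hubs). [ours] -/
theorem syncPair_marginal_fst (hW : ∀ v, 0 < W v) (hacc : ∀ h v, acc h v = min 1 (W h / W v)) (hK : 1 ≤ K)
    (hsumX : ∑ v, NX v = K + 1) (hsumY : ∑ v, NY v = K + 1)
    (hKX : ∀ h v, h ≠ v → KX h v = if NX h = 0 then 0 else (NX v : ℝ) / K * acc h v) (hKXd : ∀ h, KX h h = 1 - ∑ v ∈ univ.erase h, KX h v)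
    (hKYd : ∀ h, KY h h = 1 - ∑ v ∈ univ.erase h, KY h v)
    (hC : ∀ hX hY v, C hX hY v = min ((NX v : ℝ) - (if v = hX then 1 else 0)) ((NY v : ℝ) - (if v = hY then 1 else 0)))
    (hPX : ∀ hX hY v, PX hX hY v = ((NX v : ℝ) - (if v = hX then 1 else 0)) - C hX hY v)
    (hPY : ∀ hX hY v, PY hX hY v = ((NY v : ℝ) - (if v = hY then 1 else 0)) - C hX hY v)
    (hd : ∀ hX hY, d hX hY = ∑ v, PX hX hY v)
    (hKp : ∀ hX hY a' b', Kp (hX, hY) (a', b') = if NX hX = 0 ∨ NY hY = 0 then KX hX a' * KY hY b' else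
      (∑ v, C hX hY v / K * (min (acc hX v) (acc hY v) * (if a' = v ∧ b' = v then (1 : ℝ) else 0)
          + (acc hX v - min (acc hX v) (acc hY v)) * (if a' = v ∧ b' = hY then (1 : ℝ) else 0)
          + (acc hY v - min (acc hX v) (acc hY v)) * (if a' = hX ∧ b' = v then (1 : ℝ) else 0)
          + (1 - max (acc hX v) (acc hY v)) * (if a' = hX ∧ b' = hY then (1 : ℝ) else 0))
      + ∑ a, ∑ b, PX hX hY a * PY hX hY b / (d hX hY * K) * (min (acc hX a) (acc hY b) * (if a' = a ∧ b' = b then (1 : ℝ) else 0)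
          + (acc hX a - min (acc hX a) (acc hY b)) * (if a' = a ∧ b' = hY then (1 : ℝ) else 0)
          + (acc hY b - min (acc hX a) (acc hY b)) * (if a' = hX ∧ b' = b then (1 : ℝ) else 0)
          + (1 - max (acc hX a) (acc hY b)) * (if a' = hX ∧ b' = hY then (1 : ℝ) else 0)))) (hX hY a' : S) :
    ∑ b', Kp (hX, hY) (a', b') = KX hX a' := by
  by_cases hleg : NX hX = 0 ∨ NY hY = 0
  · simp_rw [hKp, if_pos hleg]
    rw [← mul_sum, starHub_rowsum hKYd, mul_one]
  · simp_rw [hKp, if_neg hleg]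
    rw [syncPair_rowX hsumX hsumY hC hPX hPY hd]
    exact hubRow_eq_levels hW hacc hK hsumX hKX hKXd (not_or.mp hleg).1 a'

/-- **THE SECOND MARGINAL IS `K_Y`.** [ours] -/
theorem syncPair_marginal_snd (hW : ∀ v, 0 < W v) (hacc : ∀ h v, acc h v = min 1 (W h / W v)) (hK : 1 ≤ K)
    (hsumX : ∑ v, NX v = K + 1) (hsumY : ∑ v, NY v = K + 1)
    (hKXd : ∀ h, KX h h = 1 - ∑ v ∈ univ.erase h, KX h v)
    (hKY : ∀ h v, h ≠ v → KY h v = if NY h = 0 then 0 else (NY v : ℝ) / K * acc h v) (hKYd : ∀ h, KY h h = 1 - ∑ v ∈ univ.erase h, KY h v)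
    (hC : ∀ hX hY v, C hX hY v = min ((NX v : ℝ) - (if v = hX then 1 else 0)) ((NY v : ℝ) - (if v = hY then 1 else 0)))
    (hPX : ∀ hX hY v, PX hX hY v = ((NX v : ℝ) - (if v = hX then 1 else 0)) - C hX hY v)
    (hPY : ∀ hX hY v, PY hX hY v = ((NY v : ℝ) - (if v = hY then 1 else 0)) - C hX hY v)
    (hd : ∀ hX hY, d hX hY = ∑ v, PX hX hY v)
    (hKp : ∀ hX hY a' b', Kp (hX, hY) (a', b') = if NX hX = 0 ∨ NY hY = 0 then KX hX a' * KY hY b' else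
      (∑ v, C hX hY v / K * (min (acc hX v) (acc hY v) * (if a' = v ∧ b' = v then (1 : ℝ) else 0)
          + (acc hX v - min (acc hX v) (acc hY v)) * (if a' = v ∧ b' = hY then (1 : ℝ) else 0)
          + (acc hY v - min (acc hX v) (acc hY v)) * (if a' = hX ∧ b' = v then (1 : ℝ) else 0)
          + (1 - max (acc hX v) (acc hY v)) * (if a' = hX ∧ b' = hY then (1 : ℝ) else 0))
      + ∑ a, ∑ b, PX hX hY a * PY hX hY b / (d hX hY * K) * (min (acc hX a) (acc hY b) * (if a' = a ∧ b' = b then (1 : ℝ) else 0)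
          + (acc hX a - min (acc hX a) (acc hY b)) * (if a' = a ∧ b' = hY then (1 : ℝ) else 0)
          + (acc hY b - min (acc hX a) (acc hY b)) * (if a' = hX ∧ b' = b then (1 : ℝ) else 0)
          + (1 - max (acc hX a) (acc hY b)) * (if a' = hX ∧ b' = hY then (1 : ℝ) else 0)))) (hX hY b' : S) :
    ∑ a', Kp (hX, hY) (a', b') = KY hY b' := by
  by_cases hleg : NX hX = 0 ∨ NY hY = 0
  · simp_rw [hKp, if_pos hleg]
    rw [← sum_mul, starHub_rowsum hKXd, one_mul]
  · simp_rw [hKp, if_neg hleg]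
    rw [syncPair_rowY hsumX hsumY hC hPX hPY hd]
    exact hubRow_eq_levels hW hacc hK hsumY hKY hKYd (not_or.mp hleg).2 b'

end SyncPair

end Summit.Ventures.LatticeQCDFlow.Scaling
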